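import Mathlib
import HarnessLib
import Summits.HubbardSuperconductivity.HubbardSuperconductivity.Theorems.KLProgrammeH10TwoPointLimitPerturbedCell
import Summits.HubbardSuperconductivity.HubbardSuperconductivity.Theorems.KLProgrammeH10TwoPointLimitFramePerturbation

/-!
# Route `KLProgramme` — K3 engine child `KLRegimeEngineV17F2` (stmt-HubbardSuperconductivity-20437), stub (b) import ι₂ at levels `F ≥ 3`:
# the THREE-ANCHORED four-sector count for THIN shells — an ABSOLUTE constant (no `2ⁿ`, no `n + 1`)

Cell gate-hubbard-kl, seat hubbard-kl-k3c2-p3 (g14), row «sector-counting import», located «(ℓ)-IMPORT-ι₂-FLOOR» (KL STATUS 2026-08-29): the floor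
import of the F-law at four legs (`…TowerImportP2Floor.klTowerMuLevF_two_le_floor_import`) reads, at the level-counts `F = 3, 4` (tracks `2, 3`, unit `ε³`),
a THREE-ANCHOR count `N₃` of the engine's sector constraint set.  This file is its model half and frame layer, the three-anchored twin of p4's
`anchoredSectorCount_thin_perturbed` / `…_frame` / `…_frameOK` (…PerturbedAnchoredSectorCountThin, …FrameAnchoredSectorCountThin): sectors of angular
width `w = π/2ⁿ`, shells of thickness `c_T·w²` around the perturbed curve `{ε₀ + δ = μ}` (`|δ| ≤ κ`, `κ`-Lipschitz on the square, `κ < Dt_min`), four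
legs with momentum conservation modulo `2πℤ²`, the sectors of THREE legs prescribed: the number of sectors of the fourth is `≤ K` — an absolute
constant (uniform in `δ`, `u`, `μ ∈ [μ₁, μ₂]`, `n`, `G` and the three anchors).  Proof: each anchored leg lies within `2·D_cell·w` of the curve point at
its sector's centre (`cell_perturbed`, as in p4's count), so the fourth leg is within `6·D_cell·w` of a determined point, and
`relCount_lastLeg_perturbedCurve_le` (…PerturbedCell §4, «the last leg is determined») bounds its sectors by `3(2π√2·8D_cell/u_min + 1)`.

* §1 **`threeAnchoredSectorCount_thin_perturbed`** (model); §2 **`threeAnchoredSectorCount_thin_frame`** (every `C⁴ᵥ` frame of small `C²` size),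
  **`threeAnchoredSectorCount_thin_frameOK`** (every `FrameOK` frame in the KL regime; `K` fixed BEFORE `R`).

Everything is PROVED; no definitions.  References: BGM 2006 §2.8 (2.83)–(2.89), (2.96)–(2.98), Lemma 2.5, App. A3 [cite: BenfattoGiulianiMastropietro2006];
Mastropietro 2008 (14.67) p. 223 [cite: Mastropietro2008].
-/

noncomputable section

namespace Summit.HubbardSuperconductivity.HubbardSuperconductivity.Theorems.PerturbedFermiCurve

set_option linter.dupNamespace false -- summit = problem name (single-conjunct summit), D-0017

open Classical
open Real Set
open Literature.MathematicalPhysics.QuantumLattice Literature.MathematicalPhysics.QuantumLattice.BandSectorCounting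
open Summit.HubbardSuperconductivity.HubbardSuperconductivity.Theorems.DispersionFlow
open Summit.HubbardSuperconductivity.HubbardSuperconductivity.Theorems.KLRegimeSplit

/-! ## §1 The model count: three anchored legs determine the fourth up to an absolute number of sectors -/

/-- **THE THREE-ANCHORED FOUR-SECTOR COUNT FOR THIN SHELLS ON THE PERTURBED FERMI CURVE.**  For every level window `[μ₁, μ₂] ⊂ (−4, 0)` and thickness
constant `c_T ≥ 0` there are `κ > 0` and `K` such that for every `δ` with `|δ| ≤ κ` and `κ`-Lipschitz on the closed square, every `μ ∈ [μ₁, μ₂]`, every root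
selection `u` of the perturbed curve, every `n`, every reciprocal vector `2πG` and every three anchor sectors `ω₁, ω₂, ω₃`: the number of sectors `ω₄`
admitting momenta `k_j` in the shells `|ε₀ + δ − μ| ≤ c_T w²` (`w = π/2ⁿ`) with polar angles in the prescribed sectors and `k₁ + k₂ + k₃ + k₄ = 2πG` is at
most `K` — an absolute constant. [cite: BenfattoGiulianiMastropietro2006, §2.8 (2.83)-(2.89), Lemma 2.5 (2.98), App. A3] -/
theorem threeAnchoredSectorCount_thin_perturbed :
    ∀ μ₁ μ₂ cT : ℝ, -4 < μ₁ → μ₁ ≤ μ₂ → μ₂ < 0 → 0 ≤ cT → ∃ κ : ℝ, 0 < κ ∧ ∃ K : ℝ, 0 < K ∧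
      ∀ δ : (Fin 2 → ℝ) → ℝ, (∀ k : Fin 2 → ℝ, (∀ i, |k i| ≤ π) → |δ k| ≤ κ) →
        (∀ k k' : Fin 2 → ℝ, (∀ i, |k i| ≤ π) → (∀ i, |k' i| ≤ π) → |δ k - δ k'| ≤ κ * ‖k - k'‖) →
      ∀ μ ∈ Set.Icc μ₁ μ₂, ∀ u : ℝ → ℝ, (∀ θ, IsBandFermiRadius (μ - δ (u θ • dir θ)) θ (u θ)) →
      ∀ (n : ℕ) (G : Fin 2 → ℤ) (ω₁ ω₂ ω₃ : Fin (sectorCount n)),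
      (((Finset.univ : Finset (Fin (sectorCount n))).filter (fun ω₄ : Fin (sectorCount n) =>
        ∃ k : Fin 4 → Fin 2 → ℝ, (∀ j i, |k j i| ≤ Real.pi) ∧ (∀ j, |sqDispersion (k j) + δ (k j) - μ| ≤ cT * sectorWidth n ^ 2) ∧
          sectorIndex n (Complex.arg (⟨k 0 0, k 0 1⟩ : ℂ)) = (ω₁ : ℕ) ∧
          sectorIndex n (Complex.arg (⟨k 1 0, k 1 1⟩ : ℂ)) = (ω₂ : ℕ) ∧
          sectorIndex n (Complex.arg (⟨k 2 0, k 2 1⟩ : ℂ)) = (ω₃ : ℕ) ∧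
          sectorIndex n (Complex.arg (⟨k 3 0, k 3 1⟩ : ℂ)) = (ω₄ : ℕ) ∧
          (∀ i, ∑ j, k j i = 2 * Real.pi * (G i : ℝ)))).card : ℝ) ≤ K := by
  intro μ₁ μ₂ cT hμ₁ h12 hμ₂ hcT
  -- the level range `[a', b']` and its uniform bounds
  have ha : -4 < (μ₁ - 4) / 2 := by linarith
  have hab : (μ₁ - 4) / 2 ≤ μ₂ / 2 := by linarith
  have hb : μ₂ / 2 < 0 := by linarith
  obtain ⟨B, -⟩ : ∃ B : BandBounds ((μ₁ - 4) / 2) (μ₂ / 2), B = bandBounds ha hab hb := ⟨_, rfl⟩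
  set m₀ := min (μ₁ - (μ₁ - 4) / 2) (μ₂ / 2 - μ₂) with hm₀def
  have hm₀ : 0 < m₀ := lt_min (by linarith) (by linarith)
  have hm1 : m₀ ≤ μ₁ - (μ₁ - 4) / 2 := min_le_left _ _; have hm2 : m₀ ≤ μ₂ / 2 - μ₂ := min_le_right _ _
  have hD := B.Dcell_pos; have hDt := B.Dtmin_pos; have hum := B.umin_pos; have hs := B.smax_pos; have hπ := Real.pi_pos
  -- the perturbation size, the threshold on `w` and the constant
  set κ := min 1 (min (B.Dtmin / 2) (m₀ / 4)) with hκdef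
  have hκ0 : 0 < κ := lt_min one_pos (lt_min (by positivity) (by positivity))
  have hκ1 : κ ≤ 1 := min_le_left _ _
  have hκD : κ ≤ B.Dtmin / 2 := (min_le_right _ _).trans (min_le_left _ _)
  have hκm : κ ≤ m₀ / 4 := (min_le_right _ _).trans (min_le_right _ _)
  have hκDt : κ < B.Dtmin := by linarith
  obtain ⟨w₀, hw₀⟩ : ∃ w₀ : ℝ, w₀ = min 1 (min (m₀ / 4) (1 / (cT + 1))) := ⟨_, rfl⟩
  have hw₀pos : 0 < w₀ := by rw [hw₀]; exact lt_min one_pos (lt_min (by positivity) (by positivity))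
  obtain ⟨C₀, hC₀⟩ : ∃ C₀ : ℝ, C₀ = 3 * (2 * (π * (Real.sqrt 2 * (8 * B.Dcell) / B.umin)) + 1) := ⟨_, rfl⟩
  have hC₀pos : 0 < C₀ := by rw [hC₀]; positivity
  refine ⟨κ, hκ0, C₀ + 2 * π / w₀, by positivity, ?_⟩
  intro δ hδsq hLip μ hμ u hu n G ω₁ ω₂ ω₃
  have hwpos : 0 < sectorWidth n := sectorWidth_pos n
  have hNw : (sectorCount n : ℝ) * sectorWidth n = 2 * π := sectorCount_mul_sectorWidth n
  have hsc : ∀ i : ℕ, sectorCenter n i = sectorWidth n / 2 + i * sectorWidth n := fun i => by rw [sectorCenter]; ring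
  have hcen : ∀ φ : ℝ, ∃ m : ℤ, |φ + m * (2 * π) - sectorCenter n (sectorIndex n φ)| ≤ sectorWidth n / 2 := by
    intro φ
    obtain ⟨m, hm⟩ := exists_angleRep_eq_add φ
    exact ⟨m, by rw [← hm]; exact abs_angleRep_sub_sectorCenter_le n φ⟩
  generalize hwdef : sectorWidth n = w at hwpos hNw hsc hcen ⊢
  have hNreal : (sectorCount n : ℝ) = 2 * π / w := by rw [← hNw]; field_simp
  -- the trivial bound `N = 2π/w`
  have htriv : ∀ (pr : Fin (sectorCount n) → Prop) [DecidablePred pr],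
      ((((Finset.univ : Finset (Fin (sectorCount n))).filter pr).card : ℝ)) ≤ 2 * π / w := by
    intro pr _
    have h1 := Finset.card_filter_le (Finset.univ : Finset (Fin (sectorCount n))) pr
    rw [Finset.card_univ, Fintype.card_fin] at h1
    rw [← hNreal]; exact_mod_cast h1
  by_cases hwle : w ≤ w₀
  · -- the main case
    have hw1 : w ≤ 1 := hwle.trans (by rw [hw₀]; exact min_le_left _ _)
    have hwm : w ≤ m₀ / 4 := hwle.trans (by rw [hw₀]; exact (min_le_right _ _).trans (min_le_left _ _))
    have hwT : w ≤ 1 / (cT + 1) := hwle.trans (by rw [hw₀]; exact (min_le_right _ _).trans (min_le_right _ _))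
    have hTw : cT * w ^ 2 ≤ w := by
      have h1 : cT * w ≤ 1 := by
        rw [le_div_iff₀ (by positivity)] at hwT; nlinarith [hwT, hwpos]
      nlinarith [h1, hwpos]
    have hlo : (μ₁ - 4) / 2 ≤ μ - κ - w := by linarith only [hμ.1, hm1, hκm, hwm, hm₀]
    have hhi : μ + κ + w ≤ μ₂ / 2 := by linarith only [hμ.2, hm2, hκm, hwm, hm₀]
    have hloT : (μ₁ - 4) / 2 ≤ μ - κ - cT * w ^ 2 := by linarith only [hlo, hTw]
    have hhiT : μ + κ + cT * w ^ 2 ≤ μ₂ / 2 := by linarith only [hhi, hTw]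
    -- the perturbed cell radius is at most `2 D_cell w`
    have hrad : (cT * w ^ 2 + B.smax * B.Dtmin * (w / 2)) / (B.Dtmin - κ) ≤ 2 * B.Dcell * w := by
      rw [div_le_iff₀ (sub_pos.2 hκDt)]
      unfold BandBounds.Dcell
      have e : 2 * (1 / B.Dtmin + B.smax / 2) * w * (B.Dtmin - κ) =
          (w + B.smax * B.Dtmin * (w / 2)) + (w + B.smax * B.Dtmin * (w / 2)) * (1 - 2 * κ / B.Dtmin) := by
        field_simp; ring
      rw [e]
      have h1 : 0 ≤ 1 - 2 * κ / B.Dtmin := by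
        rw [sub_nonneg, div_le_one hDt]; linarith only [hκD]
      have h2 : 0 ≤ w + B.smax * B.Dtmin * (w / 2) := by positivity
      nlinarith only [h1, h2, hTw]
    -- the cells: every admissible leg in sector `ω` is within `2 D_cell w` of the curve point at the sector's centre
    have hcell : ∀ (k : Fin 2 → ℝ) (ωj : ℕ), (∀ i, |k i| ≤ π) → |sqDispersion k + δ k - μ| ≤ cT * w ^ 2 →
        sectorIndex n (Complex.arg (⟨k 0, k 1⟩ : ℂ)) = ωj →
        ∀ i : Fin 2, |k i - (u (w / 2 + (ωj : ℝ) * w) • dir (w / 2 + (ωj : ℝ) * w)) i| ≤ 2 * B.Dcell * w := by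
      intro k ωj hk hsh hωj i
      obtain ⟨m, hm⟩ := hcen (Complex.arg (⟨k 0, k 1⟩ : ℂ))
      rw [hωj, hsc] at hm
      exact (cell_perturbed B hδsq hLip hκDt hu hk hsh hloT hhiT hm i).trans hrad
    -- the three anchored legs: cells `A i` of radius `2 D_cell w` around the centre points `P i`
    obtain ⟨ωv, hωv⟩ : ∃ ωv : Fin 3 → ℕ, ωv = ![(ω₁ : ℕ), (ω₂ : ℕ), (ω₃ : ℕ)] := ⟨_, rfl⟩
    have hωv0 : ωv 0 = (ω₁ : ℕ) := by rw [hωv]; rfl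
    have hωv1 : ωv 1 = (ω₂ : ℕ) := by rw [hωv]; rfl
    have hωv2 : ωv 2 = (ω₃ : ℕ) := by rw [hωv]; rfl
    set A : Fin 3 → Set (Fin 2 → ℝ) := fun i => {k | (∀ c, |k c| ≤ π) ∧ |sqDispersion k + δ k - μ| ≤ cT * w ^ 2 ∧
      sectorIndex n (Complex.arg (⟨k 0, k 1⟩ : ℂ)) = ωv i} with hAdef
    set P : Fin 3 → Fin 2 → ℝ := fun i => u (w / 2 + (ωv i : ℝ) * w) • dir (w / 2 + (ωv i : ℝ) * w) with hPdef
    have hA : ∀ i, ∀ k ∈ A i, ∀ c : Fin 2, |k c - P i c| ≤ 2 * B.Dcell * w := by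
      intro i k hk c
      rw [hAdef, Set.mem_setOf_eq] at hk
      exact hcell k (ωv i) hk.1 hk.2.1 hk.2.2 c
    have hrel := relCount_lastLeg_perturbedCurve_le B hδsq hLip hκDt hu hwpos hNw (η := cT * w ^ 2) (α := w / 2)
      (by positivity) (by positivity) hloT hhiT A P (fun _ => 2 * B.Dcell * w) (fun _ => by positivity) hA
      (fun _ => (1 : ℝ)) (fun _ => Or.inl rfl) 1 (Or.inl rfl) G
    -- (1) the admissible fourth sectors lie among those counted by `relCount_lastLeg_perturbedCurve_le`
    have hincl : (((Finset.univ : Finset (Fin (sectorCount n))).filter (fun ω₄ : Fin (sectorCount n) =>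
        ∃ k : Fin 4 → Fin 2 → ℝ, (∀ j i, |k j i| ≤ Real.pi) ∧ (∀ j, |sqDispersion (k j) + δ (k j) - μ| ≤ cT * w ^ 2) ∧
          sectorIndex n (Complex.arg (⟨k 0 0, k 0 1⟩ : ℂ)) = (ω₁ : ℕ) ∧
          sectorIndex n (Complex.arg (⟨k 1 0, k 1 1⟩ : ℂ)) = (ω₂ : ℕ) ∧
          sectorIndex n (Complex.arg (⟨k 2 0, k 2 1⟩ : ℂ)) = (ω₃ : ℕ) ∧
          sectorIndex n (Complex.arg (⟨k 3 0, k 3 1⟩ : ℂ)) = (ω₄ : ℕ) ∧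
          (∀ i, ∑ j, k j i = 2 * Real.pi * (G i : ℝ)))).card : ℝ) ≤
      ((((Finset.range (sectorCount n)).filter fun ω : ℕ => ∃ ks : Fin 3 → Fin 2 → ℝ, ∃ k : Fin 2 → ℝ,
        (∀ i, ks i ∈ A i) ∧ (∀ c, |k c| ≤ π) ∧ |sqDispersion k + δ k - μ| ≤ cT * w ^ 2 ∧
        (∃ m : ℤ, |Complex.arg (⟨k 0, k 1⟩ : ℂ) + m * (2 * π) - (w / 2 + ω * w)| ≤ w / 2) ∧
        ∀ c : Fin 2, (∑ i, (fun _ => (1 : ℝ)) i * ks i c) + 1 * k c = 2 * π * G c).card : ℝ)) := by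
      refine Nat.cast_le.2 (Finset.card_le_card_of_injOn (fun ω₄ : Fin (sectorCount n) => (ω₄ : ℕ)) ?_
        (fun a _ b _ hab => Fin.ext hab))
      intro ω₄ hω₄
      rw [Finset.coe_filter, Set.mem_setOf_eq] at hω₄
      obtain ⟨k, hk, hsh, h0, h1, h2, h3, hsum⟩ := hω₄.2
      rw [Finset.coe_filter, Set.mem_setOf_eq]
      refine ⟨Finset.mem_range.2 ω₄.isLt, fun i => k (Fin.castSucc i), k 3, ?_, hk 3, hsh 3, ?_, fun c => ?_⟩
      · intro i
        rw [hAdef, Set.mem_setOf_eq]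
        refine ⟨hk _, hsh _, ?_⟩
        match i with
        | 0 => rw [hωv0]; exact h0
        | 1 => rw [hωv1]; exact h1
        | 2 => rw [hωv2]; exact h2
      · obtain ⟨m, hm⟩ := hcen (Complex.arg (⟨k 3 0, k 3 1⟩ : ℂ))
        rw [h3, hsc] at hm
        exact ⟨m, hm⟩
      · have hs := hsum c
        rw [Fin.sum_univ_castSucc] at hs
        simpa only [one_mul, show Fin.last 3 = (3 : Fin 4) from rfl] using hs
    -- (2) the bound of the relative count is an absolute constant
    have hX : (∑ _i : Fin 3, 2 * B.Dcell * w) + (cT * w ^ 2 + B.smax * B.Dtmin * (w / 2)) / (B.Dtmin - κ) ≤ 8 * B.Dcell * w := by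
      rw [Finset.sum_const, Finset.card_univ, Fintype.card_fin, nsmul_eq_mul]
      push_cast
      linarith only [hrad]
    have hX0 : 0 ≤ (∑ _i : Fin 3, 2 * B.Dcell * w) + (cT * w ^ 2 + B.smax * B.Dtmin * (w / 2)) / (B.Dtmin - κ) := by
      have := sub_pos.2 hκDt
      positivity
    have hbound : 3 * (2 * (π * (Real.sqrt 2 * ((∑ _i : Fin 3, 2 * B.Dcell * w) +
        (cT * w ^ 2 + B.smax * B.Dtmin * (w / 2)) / (B.Dtmin - κ)) / B.umin)) / w + 1) ≤ C₀ := by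
      calc 3 * (2 * (π * (Real.sqrt 2 * ((∑ _i : Fin 3, 2 * B.Dcell * w) +
            (cT * w ^ 2 + B.smax * B.Dtmin * (w / 2)) / (B.Dtmin - κ)) / B.umin)) / w + 1)
          ≤ 3 * (2 * (π * (Real.sqrt 2 * (8 * B.Dcell * w) / B.umin)) / w + 1) := by gcongr
        _ = C₀ := by rw [hC₀]; field_simp
    calc _ ≤ _ := hincl
      _ ≤ _ := hrel
      _ ≤ C₀ := hbound
      _ ≤ C₀ + 2 * π / w₀ := le_add_of_nonneg_right (by positivity)
  · -- large sectors: the trivial bound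
    have hlt : w₀ < w := lt_of_not_ge hwle
    calc _ ≤ 2 * π / w := htriv _
      _ ≤ 2 * π / w₀ := div_le_div_of_nonneg_left (by positivity) hw₀pos hlt.le
      _ ≤ C₀ + 2 * π / w₀ := le_add_of_nonneg_left hC₀pos.le

/-! ## §2 The frame layer -/

/-- **The three-anchored thin four-sector count ON THE CURVE OF A FRAME**: for every level window `[μ₁, μ₂] ⊂ (-4, 0)` and `c_T ≥ 0` there are `κ > 0` and
`K` such that for EVERY frame `K' : TrigPolyC4v` with `C²` size `A`, `4A ≤ κ`, every `μ ∈ [μ₁, μ₂]`, every scale `n`, reciprocal vector `2πG` and anchors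
`ω₁, ω₂, ω₃`: the number of fourth sectors of angular width `π/2ⁿ` admitting momenta of the THIN frame shells `|frameLevel μ K'| ≤ c_T (π/2ⁿ)²` in the
prescribed sectors with `k₁ + k₂ + k₃ + k₄ = 2πG` is `≤ K`. [cite: BenfattoGiulianiMastropietro2006, §2.8 (2.83)-(2.89), Lemma 2.5 (2.98), App. A3] -/
theorem threeAnchoredSectorCount_thin_frame :
    ∀ μ₁ μ₂ cT : ℝ, -4 < μ₁ → μ₁ ≤ μ₂ → μ₂ < 0 → 0 ≤ cT → ∃ κ : ℝ, 0 < κ ∧ ∃ K : ℝ, 0 < K ∧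
      ∀ (K' : TrigPolyC4v) (A : ℝ), (∀ p : Momentum, ∀ j ≤ 2, ‖iteratedFDeriv ℝ j (frameShift K') p‖ ≤ A) → 4 * A ≤ κ →
      ∀ μ ∈ Set.Icc μ₁ μ₂, ∀ (n : ℕ) (G : Fin 2 → ℤ) (ω₁ ω₂ ω₃ : Fin (sectorCount n)),
      (((Finset.univ : Finset (Fin (sectorCount n))).filter (fun ω₄ : Fin (sectorCount n) =>
        ∃ k : Fin 4 → Fin 2 → ℝ, (∀ j i, |k j i| ≤ Real.pi) ∧ (∀ j, |frameLevel μ K' (WithLp.toLp 2 (k j))| ≤ cT * sectorWidth n ^ 2) ∧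
          sectorIndex n (Complex.arg (⟨k 0 0, k 0 1⟩ : ℂ)) = (ω₁ : ℕ) ∧
          sectorIndex n (Complex.arg (⟨k 1 0, k 1 1⟩ : ℂ)) = (ω₂ : ℕ) ∧
          sectorIndex n (Complex.arg (⟨k 2 0, k 2 1⟩ : ℂ)) = (ω₃ : ℕ) ∧
          sectorIndex n (Complex.arg (⟨k 3 0, k 3 1⟩ : ℂ)) = (ω₄ : ℕ) ∧
          (∀ i, ∑ j, k j i = 2 * Real.pi * (G i : ℝ)))).card : ℝ) ≤ K := by
  intro μ₁ μ₂ cT hμ₁ h12 hμ₂ hc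
  obtain ⟨κ, hκ, Kc, hKc, h⟩ := threeAnchoredSectorCount_thin_perturbed μ₁ μ₂ cT hμ₁ h12 hμ₂ hc
  -- a margin so that a root selection of the frame's curve exists
  have ha : -4 < (μ₁ - 4) / 2 := by linarith
  have hab : (μ₁ - 4) / 2 ≤ μ₂ / 2 := by linarith
  have hb : μ₂ / 2 < 0 := by linarith
  set m₀ := min (μ₁ - (μ₁ - 4) / 2) (μ₂ / 2 - μ₂) with hm₀def
  have hm₀ : 0 < m₀ := lt_min (by linarith) (by linarith)
  have hm1 : m₀ ≤ μ₁ - (μ₁ - 4) / 2 := min_le_left _ _; have hm2 : m₀ ≤ μ₂ / 2 - μ₂ := min_le_right _ _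
  refine ⟨min κ m₀, lt_min hκ hm₀, Kc, hKc, ?_⟩
  intro K' A hA hAκ μ hμ n G ω₁ ω₂ ω₃
  have hA4 : 4 * A ≤ κ := hAκ.trans (min_le_left _ _)
  have hAm : 4 * A ≤ m₀ := hAκ.trans (min_le_right _ _)
  have hA0 : 0 ≤ A := le_trans (norm_nonneg _) (hA 0 0 (by norm_num))
  obtain ⟨hδ, hκ₁, -⟩ := frameShift_toLp_small hA hA4
  set δ : (Fin 2 → ℝ) → ℝ := fun k => frameShift K' (WithLp.toLp 2 k) with hδdef
  have h2ne : (2 : WithTop ℕ∞) ≠ 0 := by norm_num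
  have hδsqA : ∀ k : Fin 2 → ℝ, (∀ i, |k i| ≤ π) → |δ k| ≤ A := fun k _ => abs_frameShift_toLp_le hA k
  have hδsq : ∀ k : Fin 2 → ℝ, (∀ i, |k i| ≤ π) → |δ k| ≤ κ := fun k _ => hδ k
  have hLip : ∀ k k' : Fin 2 → ℝ, (∀ i, |k i| ≤ π) → (∀ i, |k' i| ≤ π) → |δ k - δ k'| ≤ κ * ‖k - k'‖ :=
    fun k k' hk hk' => lipschitz_of_fderiv_le (fun k _ => ((contDiff_frameShift_toLp K' (m := 2)).differentiable h2ne) k)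
      (fun k _ => hκ₁ k) hk hk'
  have hlo : (μ₁ - 4) / 2 ≤ μ - A := by linarith [hμ.1]
  have hhi : μ + A ≤ μ₂ / 2 := by linarith [hμ.2]
  have hu := isBandFermiRadius_perturbedFermiRadius (bandBounds ha hab hb) (continuous_frameShift_toLp K') hδsqA hlo hhi
  have hmain := h δ hδsq hLip μ hμ (perturbedFermiRadius δ μ) hu n G ω₁ ω₂ ω₃
  have hfilt : ∀ ω₄ : Fin (sectorCount n),
      (∃ k : Fin 4 → Fin 2 → ℝ, (∀ j i, |k j i| ≤ Real.pi) ∧ (∀ j, |frameLevel μ K' (WithLp.toLp 2 (k j))| ≤ cT * sectorWidth n ^ 2) ∧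
          sectorIndex n (Complex.arg (⟨k 0 0, k 0 1⟩ : ℂ)) = (ω₁ : ℕ) ∧
          sectorIndex n (Complex.arg (⟨k 1 0, k 1 1⟩ : ℂ)) = (ω₂ : ℕ) ∧
          sectorIndex n (Complex.arg (⟨k 2 0, k 2 1⟩ : ℂ)) = (ω₃ : ℕ) ∧
          sectorIndex n (Complex.arg (⟨k 3 0, k 3 1⟩ : ℂ)) = (ω₄ : ℕ) ∧
          (∀ i, ∑ j, k j i = 2 * Real.pi * (G i : ℝ))) ↔
      (∃ k : Fin 4 → Fin 2 → ℝ, (∀ j i, |k j i| ≤ Real.pi) ∧ (∀ j, |sqDispersion (k j) + δ (k j) - μ| ≤ cT * sectorWidth n ^ 2) ∧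
          sectorIndex n (Complex.arg (⟨k 0 0, k 0 1⟩ : ℂ)) = (ω₁ : ℕ) ∧
          sectorIndex n (Complex.arg (⟨k 1 0, k 1 1⟩ : ℂ)) = (ω₂ : ℕ) ∧
          sectorIndex n (Complex.arg (⟨k 2 0, k 2 1⟩ : ℂ)) = (ω₃ : ℕ) ∧
          sectorIndex n (Complex.arg (⟨k 3 0, k 3 1⟩ : ℂ)) = (ω₄ : ℕ) ∧
          (∀ i, ∑ j, k j i = 2 * Real.pi * (G i : ℝ))) := by
    intro ω₄
    simp only [frameLevel_toLp, hδdef]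
  rw [Finset.filter_congr fun ω₄ _ => hfilt ω₄]
  exact hmain

/-- **The three-anchored thin four-sector count ON EVERY ADMISSIBLE FRAME IN THE KL REGIME**: for the window and `c_T` there is `K` (fixed BEFORE the
renormalisation constants `R`), and for every `R` thresholds `c₃, U₀ > 0`, such that for every `0 < c ≤ c₃`, `0 < U ≤ U₀`, `klBetaMin ≤ β ≤ e^{c/U²}`,
`μ ∈ [μ₁, μ₂]`, every frame with `FrameOK R U (nScales β) ν K`, and every `n, G, ω₁, ω₂, ω₃`, the three-anchored thin count is `≤ K`.
[cite: BenfattoGiulianiMastropietro2006, §2.8 (2.83)-(2.89), Lemma 2.5 (2.98), App. A3] -/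
theorem threeAnchoredSectorCount_thin_frameOK :
    ∀ μ₁ μ₂ cT : ℝ, -4 < μ₁ → μ₁ ≤ μ₂ → μ₂ < 0 → 0 ≤ cT → ∃ K : ℝ, 0 < K ∧ ∀ R : RenConsts, (∀ j, 0 ≤ R.Gfr j) →
      ∃ c₃ : ℝ, 0 < c₃ ∧ ∃ U₀ : ℝ, 0 < U₀ ∧
      ∀ c : ℝ, 0 < c → c ≤ c₃ → ∀ U : ℝ, 0 < U → U ≤ U₀ → ∀ β : ℝ, klBetaMin ≤ β → β ≤ Real.exp (c / U ^ 2) →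
      ∀ μ ∈ Set.Icc μ₁ μ₂, ∀ (ν : ℝ) (K' : TrigPolyC4v), FrameOK R U (nScales β) ν K' →
      ∀ (n : ℕ) (G : Fin 2 → ℤ) (ω₁ ω₂ ω₃ : Fin (sectorCount n)),
      (((Finset.univ : Finset (Fin (sectorCount n))).filter (fun ω₄ : Fin (sectorCount n) =>
        ∃ k : Fin 4 → Fin 2 → ℝ, (∀ j i, |k j i| ≤ Real.pi) ∧ (∀ j, |frameLevel μ K' (WithLp.toLp 2 (k j))| ≤ cT * sectorWidth n ^ 2) ∧
          sectorIndex n (Complex.arg (⟨k 0 0, k 0 1⟩ : ℂ)) = (ω₁ : ℕ) ∧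
          sectorIndex n (Complex.arg (⟨k 1 0, k 1 1⟩ : ℂ)) = (ω₂ : ℕ) ∧
          sectorIndex n (Complex.arg (⟨k 2 0, k 2 1⟩ : ℂ)) = (ω₃ : ℕ) ∧
          sectorIndex n (Complex.arg (⟨k 3 0, k 3 1⟩ : ℂ)) = (ω₄ : ℕ) ∧
          (∀ i, ∑ j, k j i = 2 * Real.pi * (G i : ℝ)))).card : ℝ) ≤ K := by
  intro μ₁ μ₂ cT hμ₁ h12 hμ₂ hcT
  obtain ⟨κ, hκ, Kc, hKc, h⟩ := threeAnchoredSectorCount_thin_frame μ₁ μ₂ cT hμ₁ h12 hμ₂ hcT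
  refine ⟨Kc, hKc, fun R hR => ?_⟩
  obtain ⟨c₃, hc₃, U₀, hU₀, hthr⟩ := frame_thresholds hR hκ
  refine ⟨c₃, hc₃, U₀, hU₀, ?_⟩
  intro c hc hcle U hU hUle β hβmin hβc μ hμ ν K' hK' n G ω₁ ω₂ ω₃
  exact h K' _ (fun p j hj => norm_iteratedFDeriv_frameShift_le_of_frameOK_regime hR hc.le hβmin hβc hK' p hj)
    (hthr c U hc.le hcle hU hUle) μ hμ n G ω₁ ω₂ ω₃

end Summit.HubbardSuperconductivity.HubbardSuperconductivity.Theorems.PerturbedFermiCurve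

end
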